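import Literature.MathematicalPhysics.QuantumLattice.FermiRG.FST2Regularity
import Mathlib.MeasureTheory.Measure.Haar.OfBasis
import Mathlib.MeasureTheory.Integral.Bochner.Basic
import Mathlib.Analysis.Calculus.IteratedDeriv.Defs
import HarnessLib

/-!
# Feldman–Salmhofer–Trubowitz II: the scale decomposition, the scale-zero effective action (Lemma 2.2),
# and the second-order strings estimates (Lemma 3.1, Theorem 3.5)

Topic `Literature/MathematicalPhysics/QuantumLattice/FermiRG`; continues `FST2Hypotheses.lean` (hypotheses
(A1)–(A5), `Crystal`, `FermiCurveParam`, `GeomConstants`) and `FST2Regularity.lean` (`HypA3Global`, `lComb`,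
the gap binder `SecondOrderData`). Source:

* [II] J. Feldman, M. Salmhofer, E. Trubowitz, *Perturbation theory around non-nested Fermi surfaces II.
  Regularity of the moving Fermi surface: RPA contributions*, Comm. Pure Appl. Math. **51** (1998)
  1133–1246, arXiv:cond-mat/9701073 (`FeldmanSalmhoferTrubowitz1998`); locators `p.N Lm` = chunk
  `pNNNN.txt`, line `m`, of the `lit read arxiv:cond-mat/9701073` render of the arXiv TeX (NOT journal
  pages); `(foo)` = TeX display label `\EQN\foo`.
* [I] J. Feldman, M. Salmhofer, E. Trubowitz, *Perturbation theory around non-nested Fermi surfaces I.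
  Keeping the Fermi surface fixed*, J. Stat. Phys. **84** (1996) 1209–1336, arXiv:cond-mat/9509006
  (`FeldmanSalmhoferTrubowitz1996`), for the coordinates `(ρ, θ)` of its Lemma 2.1 (render
  `paper:arxiv-cond-mat_9509006`, p.13 L30–117).

PRINTED NUMBERS. The render drops the numbers of `\Lem`/`\The` items; they are reconstructed by order of
appearance within each chapter and corroborated where the TeX hard-codes them: Chapter 2 — Lemma 2.1
(`\Lem\wBound`, typed in `FST2Regularity.lean`), **Lemma 2.2** (`\Lem\UVpart`, p.10 L90–98); Chapter 3 —
**Lemma 3.1** (`\Lem\jaythree`, p.15 L36–46), Lemma 3.2 (`\Lem\findCP`, p.16 L1–14, typed in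
`FST2Regularity.lean`), Lemma 3.3 (the factorisation lemma, p.16 L102–171), Lemma 3.4 (the `ρ`-dependence of
the critical points, p.18 L58–75), **Theorem 3.5** (the strings theorem, p.18 L91–138; [II] itself writes
"the regular and singular region are chosen as in the proof of Theorem 3.5", p.22 L56, and [III,
arXiv:cond-mat/9705272, p.17 L105–107] cites "the change of variable arguments of Theorem II.3.5").

## What is typed (gate-hubbard-kl wave rows `FST2.L.UVpart`, `FST2.L.jaythree`, `FST2.T3.x`)

* §1 the covariance and its scale decomposition [II §2.3–2.5]: `freePropagator` `C(ω,E) = 1/(iω - E)`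
  (p.10 L1–8), the scale parameter and cutoff function `ScaleCutoff M` (`M ≥ max{4³, 1/r₀}`,
  `a ∈ C^∞(ℝ₀⁺, [0,1])`, p.10 L56–59), `C₀ = a C`, `C_{<0} = (1-a) C` ((sczerC) p.10 L60–63),
  `f(x) = a(x) - a(x/M²)` and the slice propagators `C_j` ((CpzE) p.11 L8–12), the support indicator
  `𝟙(|ip₀ - E| ≤ M^j)` ((shellj) p.11 L16–20);
* §2 **Lemma 2.2** (`\Lem\UVpart`): "Assume (A1)_{k,h} and (A2)_{k,h}, `k ≥ 2`, `h ≥ 0`. The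
  `V^{(0)}_{m,r}` are all bounded and `C^{k,h}` in the external momenta, i.e.
  `|(V^{(0)})_{m,r}|_{k,h} ≤ K(m)^r r!`" (SSS) — TYPED AROUND THE GAP `G-t4-1` of the wave (the kernels
  `V^{(0)}_{m,r}` of the scale-zero effective action `𝒱_eff^{(0)} = log ∫ dμ_{C₀} e^{λV^{(0)}}`, a formal
  power series in `λ` whose coefficients are sums of Feynman integrals with the conditionally convergent
  propagator `C₀`, p.10 L64–86, are NOT constructed in the tree): a predicate `UVpartRegularity` in the
  binder `V0 : ScaleZeroData E` standing for the map `(e, v̂) ↦ (V^{(0)}_{m,r})_{m,r}`, exactly as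
  Theorem 1.2 was typed in `FST2Regularity.SecondOrderRegularity`. Nothing is asserted; no named fact.
* §3 the radial and angular coordinates `(ρ, θ) ↦ p(ρ, θ)`, `e(p(ρ,θ)) = ρ`, of [II §2.2 p.8 L35–60]
  (= [I, Lemma 2.1]: integral curves of a `C^∞` unit vector field `u` transversal to `S`, started on the
  constant-speed angular coordinate `θ` of `S`, [II] p.9 L40–62 and p.15 L55–57) as the DATA structure
  `TubularCoords cr e k r₀` (`d = 2`); in [II] this object is constructed, here it is a hypothesis
  binder of Theorem 3.5 (the tree constructs only its `ρ = 0` slice, `FST2FermiCurveParam.lean`).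
* §4 the second-order graphs of [II §3.1–3.2]: `lCombFM` (the linear combinations `L_b` of (Ladef) on
  frequency–momentum pairs, (eazea) p.13 L81–91), the amplitudes `P` of the 'polarization' and 'vertex'
  graphs ((voilaP) p.12 L47–60 with (twobodyint) p.7 L7), `P_π` (p.13 L92–93), the general strings
  integral `X^{b,ν}_j` ((Xuljbulnudef) p.18 L116–121) and the scale-decomposed second-order value
  `Y^π_j` ((Yuljpi) p.13 L73–79) as its instance;
* §5 **Lemma 3.1** (`\Lem\jaythree`) as a NAMED FACT `LemmaJaythree` (D-0014);
* §6 **Theorem 3.5** (the strings theorem) as a NAMED FACT `StringsTheorem` (D-0014).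

## Faithfulness notes (for the referee)

* Lemma 3.1 is printed "for every `s ≤ k` … `sup_{θ∈S} |∂^k_θ Y^π_j(0, p(0,σ))| ≤ Δ_s |P|_s M^{j₁+j₂}
  {M^{-j₃}|j₃| if s ≤ k-1; M^{-3j₃/2}|j₃| if s = k}`" (jthree). The derivative order `k` with cases in `s`,
  and the argument `σ` under `sup_θ`, are misprints for `∂^s_θ` and `θ`: the proof (p.20 L162–p.21 L50)
  takes ONE `θ`-derivative of `Y^π_j(0, p(0,θ))` and applies Theorem 3.5 with `s - 1 ≤ k - 1` further
  derivatives, which yields exactly the two printed cases in `s`. Typed with `∂^s_θ`, `s ≤ k`, at `θ`.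
* Lemma 3.1 carries no hypothesis line of its own ("Let `d = 2`"); it is the `d = 2` step of Theorem 1.2
  (i) ("this Lemma immediately implies Theorem 1.2 for `d = 2`", p.15 L48) inside Chapter 3, whose standing
  assumptions are those of Theorem 1.2 (i): (A1)_{k,h}, (A2)_{k,h}, (A3)–(A5), `k ≥ 2` (p.3 L51–56), the
  scale parameter `M ≥ max{4³, 1/r₀}` and cutoff of §2.4, and the constant-speed angular coordinate of
  §2.2 (p.15 L55–57). All of these are typed as hypotheses ((A3) with both halves, `HypA3` and
  `HypA3Global`, as everywhere in this series of files).
* Theorem 3.5's hypothesis line is garbled in the render ("Let `d = 2`, and k,0 and –hold", p.18 L91–92: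
  an assumption macro with arguments `{k,0}` and an en-dash range of assumption macros). Since the theorem
  concerns abstract strings and an abstract amplitude (no `v̂` occurs), the `{k,0}` macro is (A2)_{k,0};
  the range is read as (A3)–(A5) ((A5) is in force throughout §3.3–3.5: "In this section, we will use
  (A5)", p.15 L55; Lemma 3.2 assumes (A2)_{2,0}, (A3), (A5)). Typed with (A2)_{k,0}, (A3) (both halves),
  (A4), (A5) — if the printed range is shorter, the typed fact is the weaker statement.
* "Depends only on": [II] prints "`Δ_s` depending on `|e|_s`, `g₀`, and `w₀`" (Lemma 3.1) and "`Q_s`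
  depends only on `s`, the constants `Γ_{l,ν,s}`, `r₀`, `w₀`, and `|e|_s`" (Theorem 3.5). TYPED WEAKER:
  the constants are quantified AFTER the band `e`, the crystal, the scale parameter `M`, the cutoff and
  the coordinate datum (so they may depend on all of these), and BEFORE the interaction `v̂` / the
  amplitude `A`, the strings `S^{(l)}`, the scales `j`, the indices `ν, b, π` and the point `θ` — i.e. the
  uniformity in the scales (the content used in every scale sum of [II], [III]) and in `v̂`, `A`, `S^{(l)}`
  (through `|P|_s`, `|A|_s`, `Γ`) is kept, the uniformity over the class of bands `e` with given
  `(r₀, w₀, |e|_s)` is not asserted (the tree has no canonical construction of the coordinates of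
  [I, Lemma 2.1], on which that uniformity rides, p.21 L52–56).
* Norms: [II]'s `|f|_s = sup Σ_{|α|≤s} |D^α f|` (p.6 L85–104) is replaced by the tree's
  `Literature.Analysis.FunctionSpaces.eContDiffHolderNorm s 0 f` (sum of the sup norms of the Fréchet
  derivatives of order `≤ s` plus the oscillation of the `s`-th), and `max_{|α|=s}|D^α f(p)|` in the
  scale hypotheses by `‖iteratedFDeriv ℝ s f p‖`; these are equivalent up to combinatorial factors
  depending on `s` and `d` only, which the existentially quantified constants absorb.
* Scales are negative integers throughout [II] (`j < 0` in (CpzE)); Theorem 3.5 prints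
  "`j₁ ≤ j₂ ≤ j₃`" and Lemma 3.1 "`max{j₁,j₂} ≤ j₃ < 0`"; both are typed with `j₃ ≤ -1` (for `j₃ = 0` the
  printed right sides vanish through the factor `|j₃|`).
* Integrals over `ℝ × 𝓑` are written as integrals over `ℝ × F` (representatives) against Lebesgue measure,
  for torus-periodic integrands; the two hygiene hypotheses "`F` is measurable and bounded" (true for the
  printed example `F = [-π, π)^d`, p.6 L112) make this the printed torus integral. The normalisation
  `đp = d^{d+1}p/(2π)^{d+1}` (p.11 L127) is kept in `Y^π_j`; (Xuljbulnudef) prints plain `dp₁ dp₂`.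
* Spin sums: [II] uses "matrix notation for the spin sums … inessential for the regularity problem"
  (p.11 L125–127); the amplitudes `P` are typed exactly as displayed in (voilaP), without spin traces.

## What is NOT here

* The bound (shellj) on `D^α C_j` (p.11 L16–29, "easy to prove, see [I], Lemmas 2.1 and 2.3") and the
  Jacobian bounds of [I, Lemma 2.1 (iv)]: results of [I], not licensed in this wave (not restated).
* Lemma 3.3, Lemma 3.4, the Hölder version of the strings theorem (the theorem [III] cites as II.3.8, with
  the Hölder hypotheses of p.21 L181ff) and Chapter 4 (the RPA/'wicked ladder' graphs, Theorem 1.3).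
* Any construction of `V^{(0)}_{m,r}` or of the coordinates; any instantiation at a model; anything about
  the Kohn–Luttinger programme. Nothing in this file asserts or denies its hypothesis H1.
-/

noncomputable section

open Set Filter MeasureTheory
open scoped NNReal ENNReal Topology

namespace Literature.MathematicalPhysics.QuantumLattice.FermiRG

open Literature.Analysis.FunctionSpaces (MemContDiffHolder eContDiffHolderNorm eSupNorm)

/-! ### §1 The covariance and its scale decomposition [II §2.3–2.5, p.10 L1–p.11 L35] -/

/-- FST2.cov · [II] §2.3 · p.10 L1–8 ((prescri)). The free propagator `C(ω, E) = e^{iω0⁺}/(iω - E)` of the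
independent electrons, `(G₀)_{αα'}(p) = δ_{αα'} C(p₀, e(p))`. We record the rational function
`1/(iω - E)`; the boundary prescription `e^{iω0⁺}` (p.10 L9–24) only affects `p₀`-integrals of a single
propagator and "is omitted in the infrared part since large `p₀` do not occur there" (p.11 L5–7). Junk
value `0` at `ω = E = 0`. [cite: FeldmanSalmhoferTrubowitz1998, §2.3 (arXiv p.10 L1–8)] -/
def freePropagator (ω E : ℝ) : ℂ := 1 / (Complex.I * ω - E)

/-- FST2.cov · [II] §2.4 · p.10 L56–59. The scale parameter `M` and the ultraviolet cutoff function: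
"Let `M ≥ max{4³, 1/r₀}` (then `|e(p)| < M⁻¹` implies `|ρ| < r₀`), and let `a ∈ C^∞(ℝ₀⁺, [0,1])` be such
that `a(x) = 0` for `0 ≤ x ≤ M⁻⁴`, `a(x) = 1` for `x ≥ M⁻²`, and `a'(x) > 0` for all `x ∈ (M⁻⁴, M⁻²)`."
Recorded as data (`a` extended by `0` to the negative axis, which keeps it smooth); the size condition on
`M` is stated where it is used. [cite: FeldmanSalmhoferTrubowitz1998, §2.4 (arXiv p.10 L56–59)] -/
structure ScaleCutoff (M : ℝ) where
  /-- the cutoff function `a` -/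
  a : ℝ → ℝ
  contDiff : ContDiff ℝ (⊤ : ℕ∞) a
  mem_Icc : ∀ x, a x ∈ Icc (0 : ℝ) 1
  eq_zero : ∀ x, x ≤ (M ^ 4)⁻¹ → a x = 0
  eq_one : ∀ x, (M ^ 2)⁻¹ ≤ x → a x = 1
  deriv_pos : ∀ x, (M ^ 4)⁻¹ < x → x < (M ^ 2)⁻¹ → 0 < deriv a x

namespace ScaleCutoff

variable {M : ℝ} (χ : ScaleCutoff M)

/-- FST2.cov · [II] eq. (sczerC) · p.10 L60–61: the scale-zero part `C₀(p₀, E) = a(p₀² + E²) C(p₀, E)`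
("where `p₀² + E² > 0`"; it "has no infrared singularity", p.10 L87–88).
[cite: FeldmanSalmhoferTrubowitz1998, §2.4 eq. (sczerC) (arXiv p.10 L60–61)] -/
def covZero (ω E : ℝ) : ℂ := (χ.a (ω ^ 2 + E ^ 2) : ℂ) * freePropagator ω E

/-- FST2.cov · [II] eq. (sczerC) · p.10 L62: the infrared part `C_{<0}(p₀, E) = (1 - a(p₀² + E²)) C(p₀, E)`
("where `p₀² + E²` can get arbitrarily close to zero").
[cite: FeldmanSalmhoferTrubowitz1998, §2.4 eq. (sczerC) (arXiv p.10 L62)] -/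
def covIR (ω E : ℝ) : ℂ := ((1 - χ.a (ω ^ 2 + E ^ 2) : ℝ) : ℂ) * freePropagator ω E

/-- FST2.cov · [II] §2.5 · p.11 L4: the slice function `f(x) = a(x) - a(x/M²)` (so that
`1 - a(x) = Σ_{j<0} f(M^{-2j} x)`). [cite: FeldmanSalmhoferTrubowitz1998, §2.5 (arXiv p.11 L4)] -/
def sliceFn (x : ℝ) : ℝ := χ.a x - χ.a (x / M ^ 2)

/-- FST2.cov · [II] eq. (CpzE) · p.11 L8–12: the propagator on scale `j < 0`,
`C_j(p₀, E) = f(M^{-2j}(p₀² + E²))/(ip₀ - E)`, `C_{<0} = Σ_{j<0} C_j`; with an infrared cutoff `I < 0` the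
sum is restricted to `j ≥ I` and `I → -∞` defines the model (p.11 L37–40).
[cite: FeldmanSalmhoferTrubowitz1998, §2.5 eq. (CpzE) (arXiv p.11 L8–12)] -/
def covSlice (j : ℤ) (ω E : ℝ) : ℂ := (χ.sliceFn (M ^ (-2 * j) * (ω ^ 2 + E ^ 2)) : ℂ) * freePropagator ω E

/-- `C₀ + C_{<0} = C` ([II] p.10 L64: "since `C = C₀ + C_{<0}`").
[cite: FeldmanSalmhoferTrubowitz1998, §2.4 (arXiv p.10 L64)] -/
theorem covZero_add_covIR (ω E : ℝ) : χ.covZero ω E + χ.covIR ω E = freePropagator ω E := by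
  simp only [covZero, covIR, Complex.ofReal_sub, Complex.ofReal_one]
  ring

/-- The cutoff function vanishes on the negative axis as well (our extension by zero).
[cite: FeldmanSalmhoferTrubowitz1998, §2.4 (arXiv p.10 L57–58)] -/
theorem a_eq_zero_of_nonpos {x : ℝ} (hx : x ≤ 0) : χ.a x = 0 :=
  χ.eq_zero x (hx.trans (by positivity))

end ScaleCutoff

/-- FST2.cov · [II] eq. (shellj) · p.11 L16–24: the support indicator `𝟙(|ip₀ - E| ≤ M^j)` of the slice
`j` ("the indicator functions take the value `1` if `X` is true and `0` otherwise"), written through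
`p₀² + E² ≤ M^{2j}`. The bound (shellj) `max_{|α|=s} |D^α C_j(p₀, e(p))| ≤ W_s M^{-(s+1)j} 𝟙(|ip₀ - e(p)| ≤ M^j)`
itself is a result of [I, Lemmas 2.1, 2.3] and is not restated here.
[cite: FeldmanSalmhoferTrubowitz1998, §2.5 eq. (shellj) (arXiv p.11 L16–24)] -/
def scaleInd (M : ℝ) (j : ℤ) (ω E : ℝ) : ℝ := if ω ^ 2 + E ^ 2 ≤ M ^ (2 * j) then 1 else 0

/-- `0 ≤ 𝟙(·) ≤ 1`. [cite: FeldmanSalmhoferTrubowitz1998, §2.5 eq. (shellj) (arXiv p.11 L23–24)] -/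
theorem scaleInd_mem_Icc (M : ℝ) (j : ℤ) (ω E : ℝ) : scaleInd M j ω E ∈ Icc (0 : ℝ) 1 := by
  unfold scaleInd; split_ifs <;> simp

/-! ### §2 Lemma 2.2 (`\Lem\UVpart`): the scale-zero effective action, typed around the gap [II p.10 L43–123] -/

/-- GAP BINDER (`G-t4-1` of the gate-hubbard-kl wave, same objects as `FST2Regularity.SecondOrderData`) ·
[II] §2.4 · p.10 L64–86. Stands for the map `(e, v̂) ↦ (V^{(0)}_{m,r})_{r ≥ 1, 0 ≤ m ≤ m̄(r)}`, the kernels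
of the scale-zero effective action: "`e^{𝒱_eff^{(0)}(λ,χ,χ̄)} = ∫ dμ_{C₀}(ψ,ψ̄) e^{λV^{(0)}(ψ+χ,ψ̄+χ̄)}`,
`𝒱_eff^{(0)}(λ,ψ,ψ̄) = Σ_{r≥1} λ^r Σ_{m=0}^{m̄(r)} ∫ dp₁…dp_{2m} δ(Σᵢ(pᵢ - p_{m+i}))
V^{(0)}_{m,r}(p₁,…,p_{2m}) Πᵢ ψ̄(pᵢ)ψ(p_{m+i})`, a formal power series in `λ`" — Gaussian Grassmann
integration with the scale-zero covariance `C₀` (`ScaleCutoff.covZero`) at the fixed scale parameter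
`M` and cutoff `a`, whose coefficients are sums of Feynman integrals with the conditionally convergent
propagator `C₀` (p.10 L26–41; [II] App. D). These objects are NOT constructed in the tree; the structure
carries NO constraint and only lets Lemma 2.2 be typed around the gap (entries outside `r ≥ 1`,
`m ≤ m̄(r)` are to be read as `0`). [cite: FeldmanSalmhoferTrubowitz1998, §2.4 (arXiv p.10 L64–86)] -/
structure ScaleZeroData (E : Type*) [NormedAddCommGroup E] [InnerProductSpace ℝ E] where
  /-- `(e, v̂) ↦ ((m, r) ↦ V^{(0)}_{m,r}(e, v̂) : (ℝ × 𝓑)^{2m} → ℂ)` -/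
  kernel : (E → ℝ) → (ℝ × E → ℂ) → (m : ℕ) → ℕ → (Fin (2 * m) → ℝ × E) → ℂ

section UVpart

variable {E : Type*} [NormedAddCommGroup E] [InnerProductSpace ℝ E] [CompleteSpace E]

/-- FST2.L.UVpart · [II] **Lemma 2.2** (TeX `\Lem\UVpart`) · p.10 L90–98 (proof: [II] Appendix D).
"Assume (A1)_{k,h} and (A2)_{k,h}, with `k ≥ 2` and `h ≥ 0`. The `V^{(0)}_{m,r}` are all bounded and
`C^{k,h}` in the external momenta, i.e. `|(V^{(0)})_{m,r}|_{k,h} ≤ K(m)^r r!` (SSS)." Remark (p.10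
L100–109, not typed): "In fact, the scale zero effective action is analytic in `λ` (so the `r!` is not
really there on the right side of (SSS)); since `C₀` has no singularity one can show that it is analytic in
`λ` in a disk independent of the volume and the temperature, by adapting the determinant bound of [FMRT];
momentum space is `ℝ × 𝓑` with `𝓑` compact, so the spatial momenta have a fixed ultraviolet cutoff and
there is no 'stability of matter' problem." Also p.10 L112–115: the bilinear term `(V^{(0)})_{1,r}` is
`C^k` and `O(λ)` and is absorbed into `e`. TYPED AROUND GAP `G-t4-1`: a predicate in the binder
`V0 : ScaleZeroData E`; the `C^{k,h}` norm is the tree's `eContDiffHolderNorm k h` on functions of the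
`2m` external frequency–momenta. It is the printed implication once `V0` is the constructed family;
nothing is asserted. [cite: FeldmanSalmhoferTrubowitz1998, Lemma 2.2 = Lemma UVpart (arXiv p.10 L90–98)] -/
def UVpartRegularity (cr : Crystal E) (V0 : ScaleZeroData E) : Prop :=
  ∀ (k : ℕ) (h : ℝ≥0) (e : E → ℝ) (v : ℝ × E → ℂ), 2 ≤ k → HypA1 cr k h v → HypA2 cr k h e →
    ∃ K : ℕ → ℝ, ∀ m r : ℕ,
      MemContDiffHolder k h (V0.kernel e v m r) ∧
        eContDiffHolderNorm k h (V0.kernel e v m r) ≤ ENNReal.ofReal (K m ^ r * (r.factorial : ℝ))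

end UVpart

/-! ### §3 The radial and angular coordinates `(ρ, θ)` in `d = 2` [II §2.2 p.8 L35–60, p.9 L40–62; I, Lemma 2.1] -/

section Coordinates

variable {E : Type*} [NormedAddCommGroup E] [InnerProductSpace ℝ E] [CompleteSpace E]

/-- FST2.coords · [II] §2.2 ("Radial and angular coordinates") · p.8 L35–60, with [I, Lemma 2.1]
(render `paper:arxiv-cond-mat_9509006` p.13 L30–117) and [II] p.9 L40–62, p.15 L55–57. "For `r₀ > 0` let
`𝒜 = (-2r₀, 2r₀) × S`. Then there is an `r₀ > 0` and a `C^k`-diffeomorphism `ϕ : 𝒜 → ϕ(𝒜) ⊂ 𝓑`,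
`(ρ, σ) ↦ p = ϕ(ρ, σ)`, such that `e(ϕ(ρ, σ)) = ρ` … `ϕ` is constructed explicitly in Lemma 2.1 in [I],
using the integral curves of a `C^∞` vector field `u` that is transversal to `S` in the sense that
`u(p)·∇e(p) ≥ u₀ ≥ g₀/2` (uzerinit). We shall assume that `π` is given by this specific construction";
in `d = 2` the angular variable is "chosen as in Section 2.2, i.e. `θ ∈ ℝ/2πℤ` for all `ρ`, and
`|∂_θ p(0,θ)| = 1/P`" (p.15 L55–57). Typed, for `d = 2`, as DATA over the crystal and the band: the map
`(ρ, θ) ↦ p ρ θ`, a `C^∞` `Γ#`-periodic vector field `u` transversal to the level sets on the tube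
`{|e| < 2r₀}` (`u·∇e ≥ u₀ > 0`, (uzerinit); [I, Lemma 2.1 (ii)]), and the constant-speed angular coordinate `base` of `FST2Hypotheses.FermiCurveParam`
at `ρ = 0`; the curves `ρ ↦ p ρ θ` are the integral curves of `u` reparametrised by `ρ = e`
(`∂_ρ p = u/(u·∇e)`), `e (p ρ θ) = ρ`, `p ρ` is `2π`-periodic and injective on a period, `p` is `C^k` on
the strip `|ρ| < 2r₀`, and the coordinates cover the tube. In [II] this object is CONSTRUCTED; here it is
a hypothesis binder (the tree constructs its `ρ = 0` slice only, `FST2FermiCurveParam.lean`). The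
Jacobian `J(ρ,θ) = |det p'(ρ,θ)|` ((JacobianJ) p.8 L56–60) is not needed for the statements below.
[cite: FeldmanSalmhoferTrubowitz1998, §2.2 (arXiv p.8 L35–60)] -/
structure TubularCoords (cr : Crystal E) (e : E → ℝ) (k : ℕ) (r₀ : ℝ) where
  /-- `(ρ, θ) ↦ p(ρ, θ)` -/
  p : ℝ → ℝ → E
  /-- the transversal unit vector field `u` of [I, Lemma 2.1] -/
  u : E → E
  /-- the angular coordinate `θ ↦ p(0, θ)` of [II §2.2] -/
  base : FermiCurveParam cr e
  r₀_pos : 0 < r₀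
  p_zero : p 0 = base.γ
  u_contDiff : ContDiff ℝ (⊤ : ℕ∞) u
  u_periodic : IsLatticePeriodic cr.dualLattice u
  /-- (uzerinit) `u·∇e ≥ u₀ > 0` on the tube ([I] also normalises `|u| = 1`; only the direction field of
  `u` enters `p`, which is parametrised by `ρ = e`, so the normalisation is not recorded) -/
  u_transversal : ∃ u₀ : ℝ, 0 < u₀ ∧ ∀ q : E, |e q| < 2 * r₀ → u₀ ≤ inner ℝ (u q) (gradient e q)
  /-- `ρ ↦ p(ρ, θ)` is the integral curve of `u` through `p(0, θ)`, reparametrised by `ρ = e` -/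
  hasDerivAt_rho : ∀ θ : ℝ, ∀ ρ ∈ Ioo (-(2 * r₀)) (2 * r₀),
    HasDerivAt (fun ρ' => p ρ' θ) ((inner ℝ (u (p ρ θ)) (gradient e (p ρ θ)))⁻¹ • u (p ρ θ)) ρ
  /-- `e(p(ρ, θ)) = ρ` -/
  level : ∀ θ : ℝ, ∀ ρ ∈ Ioo (-(2 * r₀)) (2 * r₀), e (p ρ θ) = ρ
  periodic : ∀ ρ : ℝ, Function.Periodic (p ρ) (2 * Real.pi)
  contDiffOn : ContDiffOn ℝ k (Function.uncurry p) (Ioo (-(2 * r₀)) (2 * r₀) ×ˢ univ)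
  injOn : ∀ ρ ∈ Ioo (-(2 * r₀)) (2 * r₀), InjOn (p ρ) (Ico 0 (2 * Real.pi))
  /-- the coordinates cover the tube `{|e| < 2r₀}` of `𝓑` -/
  covers : ∀ q : E, |e q| < 2 * r₀ → ∃ γ ∈ cr.dualLattice, ∃ θ : ℝ, p (e q) θ = q + γ

/-- On the Fermi curve the coordinates are the angular coordinate: `e(p(0, θ)) = 0`.
[cite: FeldmanSalmhoferTrubowitz1998, §2.2 (arXiv p.8 L38–40)] -/
theorem TubularCoords.apply_zero_mem {cr : Crystal E} {e : E → ℝ} {k : ℕ} {r₀ : ℝ}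
    (Φ : TubularCoords cr e k r₀) (θ : ℝ) : Φ.p 0 θ ∈ cr.fermiSurfaceRep e := by
  rw [Φ.p_zero]; exact Φ.base.mem θ

/-- `e(p(0, θ)) = 0`. [cite: FeldmanSalmhoferTrubowitz1998, §2.2 (arXiv p.8 L38–40)] -/
theorem TubularCoords.level_zero {cr : Crystal E} {e : E → ℝ} {k : ℕ} {r₀ : ℝ}
    (Φ : TubularCoords cr e k r₀) (θ : ℝ) : e (Φ.p 0 θ) = 0 :=
  Φ.level θ 0 ⟨by linarith [Φ.r₀_pos], by linarith [Φ.r₀_pos]⟩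

end Coordinates

/-! ### §4 The second-order graphs and the strings integral [II §3.1–3.2, §3.5] -/

section Graphs

variable {E : Type*} [NormedAddCommGroup E]

/-- FST2.graphs · [II] eqs. (Ladef), (eazea) · p.13 L81–91. The linear combinations `L_b` through which the
external momentum enters the highest-scale line, on frequency–momentum pairs `p = (p₀, 𝐩)`:
"`ζ_a = L_a(z₁, z₂, z)`, `e_a = e(L_a(𝐩₁, 𝐩₂, 𝐩))`" — componentwise the `lComb` of `FST2Regularity.lean`
(`L₁ = p + p₁ - p₂`, `L₂ = p - p₁ + p₂`, `L₃ = -p + p₁ + p₂`).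
[cite: FeldmanSalmhoferTrubowitz1998, §3.1 eqs. (Ladef), (eazea) (arXiv p.13 L81–91)] -/
def lCombFM (b : ℕ) (p₁ p₂ p : ℝ × E) : ℝ × E := (lComb b p₁.1 p₂.1 p.1, lComb b p₁.2 p₂.2 p.2)

/-- Components of `lCombFM`. [cite: FeldmanSalmhoferTrubowitz1998, §3.1 eq. (eazea) (arXiv p.13 L81–84)] -/
@[simp] theorem lCombFM_fst (b : ℕ) (p₁ p₂ p : ℝ × E) : (lCombFM b p₁ p₂ p).1 = lComb b p₁.1 p₂.1 p.1 :=
  rfl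

/-- Components of `lCombFM`. [cite: FeldmanSalmhoferTrubowitz1998, §3.1 eq. (eazea) (arXiv p.13 L81–84)] -/
@[simp] theorem lCombFM_snd (b : ℕ) (p₁ p₂ p : ℝ × E) : (lCombFM b p₁ p₂ p).2 = lComb b p₁.2 p₂.2 p.2 :=
  rfl

/-- FST2.graphs · [II] §3.1 · p.12 L44–46 and Figure (secondord): the two 1PI two-legged second-order
graphs with overlapping loops, "the 'polarization' and 'vertex' diagram (so called because a polarization
bubble, resp. a vertex correction appear as pieces of the graph)".
[cite: FeldmanSalmhoferTrubowitz1998, §3.1 (arXiv p.12 L44–46)] -/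
inductive SecondOrderGraph
  | polarization
  | vertex

/-- FST2.graphs · [II] eq. (voilaP) · p.12 L47–60, with (twobodyint) `⟨p₂ p₄|V|p₁ p₃⟩ = v̂(p₂ - p₁)`
(p.7 L7). The amplitude `P(p₁, p₂, p₃, p)` of the value
`Y(p) = ∫ Π_{k=1}^3 đp_k C(z_k, e(𝐩_k)) δ^#(p₁+p₂-p₃-p) P(p₁,p₂,p₃,p)` (socalled):
`P = ⟨p p₃|V|p₁ p₂⟩² = v̂(p - p₁)²` ('polarization' graph), `P = ⟨p₁ p₂|V|p p₃⟩⟨p₃ p|V|p₁ p₂⟩ =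
v̂(p₁ - p) v̂(p₃ - p₁)` ('vertex' graph); spin sums in matrix notation, traces omitted as in [II]
(p.11 L125–127). Arguments bundled as `(p₁, p₂, p₃, p)`.
[cite: FeldmanSalmhoferTrubowitz1998, §3.1 eq. (voilaP) (arXiv p.12 L47–60)] -/
def secondOrderAmplitude (v : ℝ × E → ℂ) :
    SecondOrderGraph → (ℝ × E) × (ℝ × E) × (ℝ × E) × (ℝ × E) → ℂ
  | .polarization => fun q => v (q.2.2.2 - q.1) ^ 2
  | .vertex => fun q => v (q.1 - q.2.2.2) * v (q.2.2.1 - q.1)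

/-- FST2.graphs · [II] §3.1 · p.13 L92–93: "`P_π(p₁,p₂,p) = P(p_{π(1)}, p_{π(2)}, p_{π(3)}, p)` with `p₃`
given by `L_{π(3)}(p₁,p₂,p)`" (`π ∈ 𝒮₃`, the permutation ordering the scales, p.13 L41–47; indices
`1,2,3` are `0,1,2` of `Fin 3`). Arguments bundled as `(p₁, p₂, p)`.
[cite: FeldmanSalmhoferTrubowitz1998, §3.1 (arXiv p.13 L92–93)] -/
def secondOrderAmplitudePerm (v : ℝ × E → ℂ) (g : SecondOrderGraph) (π : Equiv.Perm (Fin 3)) :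
    (ℝ × E) × (ℝ × E) × (ℝ × E) → ℂ := fun q =>
  let ps : Fin 3 → ℝ × E := ![q.1, q.2.1, lCombFM ((π 2 : ℕ) + 1) q.1 q.2.1 q.2.2]
  secondOrderAmplitude v g (ps (π 0), ps (π 1), ps (π 2), q.2.2)

/-- For the identity permutation, `P_π(p₁,p₂,p) = P(p₁, p₂, L₃(p₁,p₂,p), p)` (the case `a = 3` of
(Ladef), the left graph of Figure (secord), p.13 L101–102).
[cite: FeldmanSalmhoferTrubowitz1998, §3.1 (arXiv p.13 L92–102)] -/
theorem secondOrderAmplitudePerm_one (v : ℝ × E → ℂ) (g : SecondOrderGraph) (p₁ p₂ p : ℝ × E) :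
    secondOrderAmplitudePerm v g 1 (p₁, p₂, p) =
      secondOrderAmplitude v g (p₁, p₂, lCombFM 3 p₁ p₂ p, p) := by
  simp [secondOrderAmplitudePerm]

variable [InnerProductSpace ℝ E] [FiniteDimensional ℝ E] [MeasurableSpace E] [BorelSpace E]

/-- FST2.T3.x (object) · [II] eq. (Xuljbulnudef) · p.18 L116–121. The strings integral
`X^{b,ν}_j(p) = ∫ dp₁ dp₂ S^{(1)}_{ν₁}(p₁) S^{(2)}_{ν₂}(p₂) S^{(3)}_{ν₃}(L_b(p₁,p₂,p)) A(p₁,p₂,p)`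
over `(ℝ × 𝓑)²`, for three strings `S 0, S 1, S 2 : ℝ × 𝓑 → ℂ` and an amplitude `A` (the scale and
`ν` labels live in the hypotheses on `S`, not in the integral). The torus integral is written over the
representatives `ℝ × F` with Lebesgue measure (volume of the inner-product space `E`).
[cite: FeldmanSalmhoferTrubowitz1998, Theorem 3.5 eq. (Xuljbulnudef) (arXiv p.18 L116–121)] -/
def stringsX (cr : Crystal E) (S : Fin 3 → ℝ × E → ℂ) (b : ℕ) (A : (ℝ × E) × (ℝ × E) × (ℝ × E) → ℂ)
    (p : ℝ × E) : ℂ :=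
  ∫ x : (ℝ × E) × (ℝ × E) in (univ ×ˢ cr.fundamentalDomain) ×ˢ (univ ×ˢ cr.fundamentalDomain),
    S 0 x.1 * S 1 x.2 * S 2 (lCombFM b x.1 x.2 p) * A (x.1, x.2, p)

/-- FST2.L.jaythree (object) · [II] eq. (Yuljpi) · p.13 L73–79 (with (eazea), (Ladef) and p.13 L92–93).
The scale-decomposed value of a second-order graph,
`Y^π_j(p) = ∫ đp₁ đp₂ C_{j₁}(z₁, e(𝐩₁)) C_{j₂}(z₂, e(𝐩₂)) C_{j₃}(ζ_{π(3)}, e_{π(3)}) P_π(p₁,p₂,p)`,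
`đp = d^{d+1}p/(2π)^{d+1}` (p.11 L127), "the external momentum `p` routed through the highest scale line
`C_{j₃}`" (p.13 L123–124): the instance of `stringsX` with the strings `C_{j_l}(p₀, e(𝐩))`, `b = π(3)`
and amplitude `P_π`. [cite: FeldmanSalmhoferTrubowitz1998, §3.1 eq. (Yuljpi) (arXiv p.13 L73–79)] -/
def secondOrderY (cr : Crystal E) (e : E → ℝ) (v : ℝ × E → ℂ) {M : ℝ} (χ : ScaleCutoff M)
    (g : SecondOrderGraph) (π : Equiv.Perm (Fin 3)) (j : Fin 3 → ℤ) (p : ℝ × E) : ℂ :=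
  (((2 * Real.pi) ^ (2 * (Module.finrank ℝ E + 1)))⁻¹ : ℝ) •
    stringsX cr (fun l q => χ.covSlice (j l) q.1 (e q.2)) ((π 2 : ℕ) + 1)
      (secondOrderAmplitudePerm v g π) p

end Graphs

/-! ### §5 Lemma 3.1 (`\Lem\jaythree`) [II p.15 L36–50] -/

/-- FST2.L.jaythree · [II] **Lemma 3.1** (TeX `\Lem\jaythree`) · p.15 L36–46 (proof p.20 L162–p.21 L50, from
Theorem 3.5). "Let `d = 2`. For every `s ≤ k`, there is a constant `Δ_s`, depending on `|e|_s`, `g₀`, and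
`w₀`, such that for all `j` with `max{j₁,j₂} ≤ j₃ < 0`,
`sup_θ |∂^s_θ Y^π_j(0, p(0,θ))| ≤ Δ_s |P|_s M^{j₁+j₂} · {M^{-j₃}|j₃| if s ≤ k-1; M^{-3j₃/2}|j₃| if s = k}`
(jthree)" (printed with `∂^k` and `σ` — misprints, see the module docstring). "This Lemma immediately
implies Theorem 1.2 for `d = 2` because the scale sum over `M^{j₁+j₂-3j₃/2}|j₃|` converges" (p.15 L48–50).
Standing hypotheses of Chapter 3 made explicit: `d = 2`, `k ≥ 2`, (A1)_{k,h}, (A2)_{k,h}, (A3) (both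
halves), (A4), (A5), geometric constants, `M ≥ max{4³, 1/r₀}` with a cutoff `a`, and the constant-speed
angular coordinate `Θ` (`Y^π_j(0, p(0,θ))` only involves `θ ↦ p(0,θ)`); hygiene: `F` measurable and
bounded. `|P|_s` is the `C^{s,0}` norm of the amplitude `P` of (voilaP). TYPED WEAKER in one respect:
`Δ_s` may depend on the band, the crystal, `M`, the cutoff and `Θ` (quantified before `Δ`), while the
uniformity in `v̂` (through `|P|_s`), in the graph, `π`, the scales `j` and `θ` is as printed. A named
fact (D-0014), not proved here. [cite: FeldmanSalmhoferTrubowitz1998, Lemma 3.1 = Lemma jaythree (arXiv p.15 L36–46)] -/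
def LemmaJaythree : Prop :=
  ∀ (E : Type) [NormedAddCommGroup E] [InnerProductSpace ℝ E] [CompleteSpace E] [FiniteDimensional ℝ E]
    [MeasurableSpace E] [BorelSpace E] (cr : Crystal E) (e : E → ℝ) (k : ℕ) (h : ℝ≥0)
    (K r₀ g₀ wmin : ℝ) (Θ : FermiCurveParam cr e) (M : ℝ) (χ : ScaleCutoff M),
    Module.finrank ℝ E = 2 → MeasurableSet cr.fundamentalDomain →
    Bornology.IsBounded cr.fundamentalDomain → 2 ≤ k →
    HypA2 cr k h e → HypA3 e → HypA3Global cr e → HypA4 cr e → HypA5 cr e →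
    GeomConstants e K r₀ g₀ wmin → max (4 ^ 3) r₀⁻¹ ≤ M →
    ∃ Δ : ℕ → ℝ, (∀ s, 0 < Δ s) ∧
      ∀ v : ℝ × E → ℂ, HypA1 cr k h v →
      ∀ (g : SecondOrderGraph) (π : Equiv.Perm (Fin 3)) (j : Fin 3 → ℤ),
        j 0 ≤ j 2 → j 1 ≤ j 2 → j 2 ≤ -1 →
        ∀ s ≤ k, ∀ θ : ℝ,
          ‖iteratedDeriv s (fun θ' => secondOrderY cr e v χ g π j (0, Θ.γ θ')) θ‖ ≤
            Δ s * (eContDiffHolderNorm s 0 (secondOrderAmplitude v g)).toReal *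
              M ^ ((j 0 : ℝ) + j 1) * |(j 2 : ℝ)| *
              (if s + 1 ≤ k then M ^ (-(j 2 : ℝ)) else M ^ (-(3 / 2 : ℝ) * j 2))

/-! ### §6 Theorem 3.5: strings of two-legged subdiagrams [II p.18 L77–138] -/

section Strings

variable {E : Type*} [NormedAddCommGroup E] [InnerProductSpace ℝ E]

/-- A function on `(ℝ × 𝓑)³` through its lift: `Γ#`-periodic in each of the three spatial arguments
([II] §2.1 p.6 L108–110, functions on the torus). [cite: FeldmanSalmhoferTrubowitz1998, §2.1 (arXiv p.6 L108–110)] -/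
def IsTorusFn₃ (cr : Crystal E) {α : Type*} (A : (ℝ × E) × (ℝ × E) × (ℝ × E) → α) : Prop :=
  ∀ γ ∈ cr.dualLattice, ∀ (q₁ q₂ q₃ : ℝ × E),
    A ((q₁.1, q₁.2 + γ), q₂, q₃) = A (q₁, q₂, q₃) ∧ A (q₁, (q₂.1, q₂.2 + γ), q₃) = A (q₁, q₂, q₃) ∧
      A (q₁, q₂, (q₃.1, q₃.2 + γ)) = A (q₁, q₂, q₃)

end Strings

/-- FST2.T3.x · [II] **Theorem 3.5** (the strings theorem; TeX `\The{...}`, label lost in the render) ·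
p.18 L91–138 (proof p.18 L140–p.21 L56). "We now prove a more general statement that implies Lemma 3.1,
and which we shall use later to bound more general graphs and also derivatives with respect to `e` …
the strings of two-legged subdiagrams that occur in general graphs and their derivatives with respect to
`e` satisfy the hypotheses of the following theorem" (p.18 L77–90). **Theorem.** "Let `d = 2`, and let
(A2)_{k,0} and (A3)–(A5) hold. Let `A ∈ C^{k-1}((ℝ × 𝒩)³, ℂ)` and for `ν ∈ {1,2,3}` let `S^{(1)}_ν`,
`S^{(2)}_ν`, `S^{(3)}_ν` be in `C^{k-1}(ℝ × 𝒩, ℂ)` and satisfy for `l ∈ {1,2,3}`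
`|D^α S^{(l)}_ν(p)| ≤ Γ_{l,ν,|α|} M^{-j_l(ν+|α|)} 𝟙(|ip₀ - e(𝐩)| ≤ M^{j_l})` for all `0 ≤ |α| ≤ k-1`
(onlyyou), and for all `s ≤ k-1`
`|∂^s_θ S^{(l)}_ν(p₀, 𝐩(ρ,θ))| ≤ Γ_{l,ν,s} M^{-νj_l} 𝟙(|ip₀ - ρ| ≤ M^{j_l})` (thunif) (where the constants
`Γ_{l,ν,s}` are increasing in `s`). Let `j = (j₁,j₂,j₃)` with `j₁ ≤ j₂ ≤ j₃`, `ν = (ν₁,ν₂,ν₃)`, and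
`X^{b,ν}_j(p) = ∫ dp₁ dp₂ S^{(1)}_{ν₁}(p₁) S^{(2)}_{ν₂}(p₂) S^{(3)}_{ν₃}(L_b(p₁,p₂,p)) A(p₁,p₂,p)`
(Xuljbulnudef), `L_b` as in (Ladef). Then, for all `s ≤ k-1`, there is `Q_s > 0` such that for all
`ν₁,ν₂,ν₃ ∈ {1,2,3}` and all `b ∈ {1,2,3}`,
`sup_θ sup_{|p₀-iρ| ≤ M^{j₁}} |∂^s_θ X^{b,ν}_j(p₀, 𝐩(ρ,θ))| ≤ Q_s |A|_s M^{j₁(2-ν₁)+j₂(2-ν₂)} ·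
{|j₃| M^{(1-ν₃)j₃} if s ≤ k-2; |j₃| M^{(1/2-ν₃)j₃} if s = k-1}` (Xuljb). The constant `Q_s` depends only on
`s`, the constants `Γ_{l,ν,s}`, `r₀`, `w₀`, and `|e|_s`." (`𝒩` is the tube around `S` on which the
coordinates `(ρ,θ)`, `e(𝐩(ρ,θ)) = ρ`, are defined, p.18 L140–141; the hypothesis line is garbled in the
render and read as explained in the module docstring.) Typed over the coordinate datum `TubularCoords`
(§3), with the strings indexed by `l ∈ Fin 3` at their own `ν_l` (only `S^{(l)}_{ν_l}` enters), global
`C^{k-1}` torus-periodic lifts (equivalent: the scale hypotheses force compact support inside the tube),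
the tree's `C^{s,0}` norm for `|A|_s` (finite by hypothesis) and `‖iteratedFDeriv‖` for `max_{|α|=s}|D^α·|`,
scales `j₃ ≤ -1`, and hygiene hypotheses "`F` measurable and bounded". TYPED WEAKER in one respect: `Q_s`
is quantified after the band, the crystal, `M` and the coordinate datum (it may depend on them), before
`A`, the strings, the scales `j`, `ν`, `b` and the point — the printed uniformity over bands with the same
`(r₀, w₀, |e|_s)` is not asserted. A named fact (D-0014), not proved here.
[cite: FeldmanSalmhoferTrubowitz1998, Theorem 3.5 (arXiv p.18 L91–138)] -/
def StringsTheorem : Prop :=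
  ∀ (E : Type) [NormedAddCommGroup E] [InnerProductSpace ℝ E] [CompleteSpace E] [FiniteDimensional ℝ E]
    [MeasurableSpace E] [BorelSpace E] (cr : Crystal E) (e : E → ℝ) (k : ℕ) (K r₀ g₀ wmin : ℝ)
    (Φ : TubularCoords cr e k r₀) (M : ℝ) (Γ : Fin 3 → ℕ → ℕ → ℝ),
    Module.finrank ℝ E = 2 → MeasurableSet cr.fundamentalDomain →
    Bornology.IsBounded cr.fundamentalDomain → 2 ≤ k →
    HypA2 cr k 0 e → HypA3 e → HypA3Global cr e → HypA4 cr e → HypA5 cr e →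
    GeomConstants e K r₀ g₀ wmin → max (4 ^ 3) r₀⁻¹ ≤ M → (∀ l ν, Monotone (Γ l ν)) →
    ∃ Q : ℕ → ℝ, (∀ s, 0 < Q s) ∧
      ∀ (j : Fin 3 → ℤ) (ν : Fin 3 → ℕ) (b : ℕ) (A : (ℝ × E) × (ℝ × E) × (ℝ × E) → ℂ)
        (S : Fin 3 → ℝ × E → ℂ),
        j 0 ≤ j 1 → j 1 ≤ j 2 → j 2 ≤ -1 →
        (∀ l, ν l = 1 ∨ ν l = 2 ∨ ν l = 3) → (b = 1 ∨ b = 2 ∨ b = 3) →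
        ContDiff ℝ (k - 1 : ℕ) A → (∀ i ≤ k - 1, eSupNorm (iteratedFDeriv ℝ i A) < ∞) →
        IsTorusFn₃ cr A →
        (∀ l, ContDiff ℝ (k - 1 : ℕ) (S l)) →
        (∀ l, ∀ γ ∈ cr.dualLattice, ∀ (p₀ : ℝ) (q : E), S l (p₀, q + γ) = S l (p₀, q)) →
        (∀ l, ∀ i ≤ k - 1, ∀ q : ℝ × E,
          ‖iteratedFDeriv ℝ i (S l) q‖ ≤
            Γ l (ν l) i * M ^ (-(j l : ℝ) * (ν l + i)) * scaleInd M (j l) q.1 (e q.2)) →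
        (∀ l, ∀ s ≤ k - 1, ∀ (p₀ ρ θ : ℝ), |ρ| < 2 * r₀ →
          ‖iteratedDeriv s (fun θ' => S l (p₀, Φ.p ρ θ')) θ‖ ≤
            Γ l (ν l) s * M ^ (-(ν l : ℝ) * j l) * scaleInd M (j l) p₀ ρ) →
        ∀ s ≤ k - 1, ∀ (θ p₀ ρ : ℝ), p₀ ^ 2 + ρ ^ 2 ≤ M ^ (2 * j 0) →
          ‖iteratedDeriv s (fun θ' => stringsX cr S b A (p₀, Φ.p ρ θ')) θ‖ ≤
            Q s * (eContDiffHolderNorm s 0 A).toReal *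
              M ^ ((j 0 : ℝ) * (2 - ν 0) + (j 1 : ℝ) * (2 - ν 1)) * |(j 2 : ℝ)| *
              (if s + 2 ≤ k then M ^ ((1 - ν 2 : ℝ) * j 2) else M ^ ((1 / 2 - ν 2 : ℝ) * j 2))

/-! ### §7 Lemma 3.1 is an instance of the strings integral (the structure of its proof, p.21 L1–50) -/

section Instances

variable {E : Type*} [NormedAddCommGroup E] [InnerProductSpace ℝ E] [FiniteDimensional ℝ E]
  [MeasurableSpace E] [BorelSpace E]

/-- `Y^π_j = (2π)^{-2(d+1)} X^{π(3)}` with the strings `S^{(l)} = C_{j_l}(p₀, e(𝐩))` and the amplitude `P_π`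
— the form in which [II] derives Lemma 3.1 from Theorem 3.5 ("Theorem 3.5 applies to both terms … take
`S^{(3)}(p) = C_{j₃}(p₀, e(𝐩))`", p.21 L14–30). By definition.
[cite: FeldmanSalmhoferTrubowitz1998, §3.5 proof of Lemma 3.1 (arXiv p.21 L1–30)] -/
theorem secondOrderY_eq_stringsX (cr : Crystal E) (e : E → ℝ) (v : ℝ × E → ℂ) {M : ℝ}
    (χ : ScaleCutoff M) (g : SecondOrderGraph) (π : Equiv.Perm (Fin 3)) (j : Fin 3 → ℤ) (p : ℝ × E) :
    secondOrderY cr e v χ g π j p =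
      (((2 * Real.pi) ^ (2 * (Module.finrank ℝ E + 1)))⁻¹ : ℝ) •
        stringsX cr (fun l q => χ.covSlice (j l) q.1 (e q.2)) ((π 2 : ℕ) + 1)
          (secondOrderAmplitudePerm v g π) p :=
  rfl

end Instances

end Literature.MathematicalPhysics.QuantumLattice.FermiRG

end
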